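import Mathlib
import HarnessLib
import Summits.NavierStokesRegularity.NavierStokesRegularity.Theorems.UnthreadedRigidityDoorUnthreadedRigidityThreadingJetsVirialRamps

/-!
# ★★ THREADING JETS, THE VIRIAL LEMMA: `virialLemmaSlice_holds : VirialLemmaSlice` — half (B′) of the ORDER-TWO SLICE LAW, by name

W2 ⟨stmt-NavierStokesRegularity-27585⟩ `UnthreadedRigidity`, line g11-1 (VIRIAL HORN card §2 (F3)), director split dss_146 (1): the two-hand split
`orderTwoSliceLawGeneric_of_split : OrderTwoLawSlice → VirialLemmaSlice → OrderTwoSliceLawGeneric` (file `…ThreadingJetsSplit`) takes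
(A) `OrderTwoLawSlice` (ns-crc-p2) and (B′) `VirialLemmaSlice` (this file).  With (A) landed, `OrderTwoSliceLawGeneric` follows BY NAME, hence
`VirialWindowSilence` (`virialWindowSilence_of_genericSliceLaw`, modulo the shell-`L⁴` fact of ns-engine-1) and the VIRIAL rungs.

THE PROOF (harmonic-free; neither spherical harmonics nor the Poisson equation of `p₀` are used).  Write `q = p₀(x₀ + ·)`, `α = strainAmpL`,
`A = angForm Y`, `A₂ = {Y, A}`, `m = (4l−1)/2`.  The premise `α(|y|)² A(y) = {Y, y·∇q}(y)` is fed to the VIRIAL INTEGRAL IDENTITY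
(`integral_virial_identity`, file `…VirialFields`: two integrations by parts against the divergence-free field `y × ∇Y ⊥ y`) with the
weight `θ(s) = κ₁(s)κ₂(s)s^{−m}`, `κ₁` a rising ramp at `s ∈ (ε², 2ε²)`, `κ₂` a falling ramp at `s ∈ (N², 2N²)` (file `…VirialWeights`):
the `θ`-term cancels (`weight_deriv_identity`), leaving `∫ α²A²θ(|y|²) = ∫ q·2κ₁′(|y|²)(|y|²)^{1−m}A₂ + ∫ q·2κ₂′(|y|²)(|y|²)^{1−m}A₂`.
The inner piece equals `∫ (q − q(0))·(…)` by the ZERO SHELL AVERAGES of `A₂` (`integral_radialTest_mul_pbr_angForm`) and is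
`≤ 16 vol(B̄₁) C M₂ · sup_{|y| ≤ 2ε}|q − q(0)|`; the outer piece is `≤ 16 vol(B̄₁) C M₂ · sup_{|y| ≥ N}|q|` (`ramp_integral_le`, scale-free).
Both are `o(1)` as `ε → 0`, `N → ∞` (continuity of `q` at `0`, decay of `q`), while the left side is `≥ c₀ > 0` as soon as `α(|y₀|)A(y₀) ≠ 0`
at one point `y₀ ≠ 0` (continuity on a ball where both ramps equal `1`).  Hence `α(|y|)A(y) = 0` off the origin; by the homogeneity
`A(cy) = c^{3l−3}A(y)` either `A ≡ 0` or `α ≡ 0` on `(0,∞)`, i.e. `virialMoment l H = 0`.  MODEL rung — no NS regularity statement is proved here.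
-/

noncomputable section

-- the summit and its single sub-problem share the name (CONVENTIONS §1), as in every Theorems file
set_option linter.dupNamespace false

namespace Summit.NavierStokesRegularity.NavierStokesRegularity.Theorems.UnthreadedRigidity.ThreadingJets

open Set Function Filter Topology MeasureTheory Metric
open scoped RealInnerProductSpace InnerProductSpace ContDiff
open Literature.Analysis.FluidPDE
open Summit.NavierStokesRegularity.NavierStokesRegularity.Theorems.UnthreadedRigidity.ProfileHorn (E3)
open Summit.NavierStokesRegularity.NavierStokesRegularity.Theorems.UnthreadedRigidity.VirialHorn
  (IsSolidHarmonic VirialAdmissible sepShellL virialMoment angForm pbr det3 strainAmpL)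

variable {l : ℕ} {Y : E3 → ℝ}

/-! ### 4. The virial lemma -/

/-- ★★ **THE VIRIAL LEMMA** `VirialLemmaSlice` ((B′), the (F3) half of the ORDER-TWO SLICE LAW; VIRIAL HORN card §2), by the harmonic-free route:
if `α(|y|)² A(y) = {Y, y·∇p₀(x₀+·)}(y)` for all `y`, with `p₀` smooth and decaying at infinity, then `α(|y|) A(y) = 0` off the origin, hence the
VIRIAL MOMENT of `H` vanishes or the ANGULAR FORM of `Y` vanishes identically.  (The Poisson equation of `p₀` is not even used.) [folklore] -/
theorem virialLemmaSlice_holds : VirialLemmaSlice := by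
  intro l x₀ Y H p₀ hl hY hH _ _ hp _ hdec hprem ξ
  -- the centred pressure slice
  set q : E3 → ℝ := fun z => p₀ (x₀ + z) with hq_def
  have hq : ContDiff ℝ (⊤ : ℕ∞) q := hp.comp (contDiff_const.add contDiff_id)
  have hq2 : ContDiff ℝ 2 q := hq.of_le (by norm_cast)
  have hqc : Continuous q := hq.continuous
  have hq0 : Tendsto q (cocompact E3) (𝓝 0) := by
    have e : q = p₀ ∘ (Homeomorph.addLeft x₀) := by funext z; simp [hq_def]
    rw [e]
    exact hdec.comp (Homeomorph.addLeft x₀).map_cocompact.le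
  have hprem' : ∀ y : E3, strainAmpL l H ‖y‖ ^ 2 * angForm Y y = pbr Y (fun z => inner ℝ z (gradient q z)) y := by
    intro y
    have hg : (fun z : E3 => inner ℝ z (gradient q z)) = fun z => inner ℝ z (gradient p₀ (x₀ + z)) := by
      funext z
      have : gradient q z = gradient p₀ (x₀ + z) := by
        unfold gradient
        rw [show q = fun z => p₀ (x₀ + z) from rfl, fderiv_comp_add_left]
      rw [this]
    rw [hg]
    exact hprem y
  -- the conclusion from the pointwise vanishing off the origin
  suffices key : ∀ y : E3, y ≠ 0 → strainAmpL l H ‖y‖ * angForm Y y = 0 by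
    by_cases hA : ∃ y₁ : E3, angForm Y y₁ ≠ 0
    · obtain ⟨y₁, hy₁⟩ := hA
      have hy₁0 : y₁ ≠ 0 := by
        intro h; apply hy₁; rw [h]; simp [angForm, pbr, det3]
      have hn₁ : 0 < ‖y₁‖ := norm_pos_iff.2 hy₁0
      have hα : ∀ r : ℝ, 0 < r → strainAmpL l H r = 0 := fun r hr => by
        have hc : 0 < r / ‖y₁‖ := div_pos hr hn₁
        have hny : ‖(r / ‖y₁‖) • y₁‖ = r := by
          rw [norm_smul, Real.norm_of_nonneg hc.le, div_mul_cancel₀ _ hn₁.ne']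
        have hAy : angForm Y ((r / ‖y₁‖) • y₁) ≠ 0 := by
          rw [angForm_smul hY hc]
          exact mul_ne_zero (zpow_ne_zero _ hc.ne') hy₁
        have h := key ((r / ‖y₁‖) • y₁) (smul_ne_zero hc.ne' hy₁0)
        rw [hny] at h
        exact (mul_eq_zero.1 h).resolve_right hAy
      have hvm : virialMoment l H = 0 := by
        unfold virialMoment
        rw [setIntegral_congr_fun measurableSet_Ioi (fun r hr => by rw [hα r hr])]
        simp
      rw [hvm, zero_mul]
    · push Not at hA
      rw [hA ξ, mul_zero]
  -- main step, by contradiction on a ball around a bad point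
  intro y₀ hy₀
  by_contra hne
  have hn₀ : 0 < ‖y₀‖ := norm_pos_iff.2 hy₀
  -- constants of the problem
  obtain ⟨C, hC0, hC⟩ := Literature.Analysis.FluidPDE.SereginSverak2002.exists_abs_deriv_smoothTransition_le
  obtain ⟨M₂, hM₂0, hM₂⟩ := exists_bound_pbr_angForm hY hl
  have hc₃0 : 0 ≤ (volume : Measure E3).real (closedBall (0 : E3) 1) := measureReal_nonneg
  set K₁ : ℝ := 16 * (volume : Measure E3).real (closedBall (0 : E3) 1) * C * M₂ with hK₁
  have hK₁0 : 0 ≤ K₁ := by positivity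
  have hl1 : (1 : ℝ) ≤ l := by exact_mod_cast hl
  have hm0 : 0 ≤ (4 * (l : ℝ) - 1) / 2 := by linarith
  -- the function `F = α² A²` and a ball around `y₀` where it is bounded below
  have hF0 : 0 < strainAmpL l H ‖y₀‖ ^ 2 * angForm Y y₀ ^ 2 := by
    have h := pow_pos (abs_pos.2 hne) 2
    rw [sq_abs] at h
    have e : strainAmpL l H ‖y₀‖ ^ 2 * angForm Y y₀ ^ 2 = (strainAmpL l H ‖y₀‖ * angForm Y y₀) ^ 2 := by ring
    rw [e]; exact h
  have hFc : ContinuousAt (fun y : E3 => strainAmpL l H ‖y‖ ^ 2 * angForm Y y ^ 2) y₀ :=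
    (((continuousAt_strainAmpL hH hn₀).comp continuous_norm.continuousAt).pow 2).mul
      (((continuous_angForm hY).continuousAt).pow 2)
  obtain ⟨ρ', hρ', hball'⟩ := Metric.eventually_nhds_iff.1
    (hFc.eventually (lt_mem_nhds (show strainAmpL l H ‖y₀‖ ^ 2 * angForm Y y₀ ^ 2 / 2 <
      strainAmpL l H ‖y₀‖ ^ 2 * angForm Y y₀ ^ 2 by linarith)))
  set ρ₀ : ℝ := min ρ' (‖y₀‖ / 2) with hρ₀_def
  have hρ₀ : 0 < ρ₀ := lt_min hρ' (by linarith)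
  have hρ₀1 : ρ₀ ≤ ρ' := min_le_left _ _
  have hρ₀2 : ρ₀ ≤ ‖y₀‖ / 2 := min_le_right _ _
  have hUpos : 0 < (volume : Measure E3).real (ball y₀ ρ₀) :=
    ENNReal.toReal_pos (measure_ball_pos volume y₀ hρ₀).ne' measure_ball_lt_top.ne
  set w₀ : ℝ := ((3 * ‖y₀‖ / 2) ^ 2) ^ (-((4 * (l : ℝ) - 1) / 2)) with hw₀_def
  have hw₀ : 0 < w₀ := Real.rpow_pos_of_pos (by positivity) _
  set c₀ : ℝ := (volume : Measure E3).real (ball y₀ ρ₀) * (strainAmpL l H ‖y₀‖ ^ 2 * angForm Y y₀ ^ 2 / 2 * w₀)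
    with hc₀_def
  have hc₀ : 0 < c₀ := by positivity
  -- the smallness scale `η`, the continuity radius `δ`, the decay radius `R`
  set η : ℝ := c₀ / (4 * K₁ + 4) with hη_def
  have hη : 0 < η := by positivity
  have hηK : 2 * K₁ * η < c₀ := by
    rw [hη_def, mul_div_assoc', div_lt_iff₀ (by positivity)]
    have : 0 < c₀ * (2 * K₁ + 4) := by positivity
    linarith [this]
  obtain ⟨δ, hδ, hδq⟩ := exists_radius_of_continuous hqc hη
  obtain ⟨R, hR, hRq⟩ := exists_radius_of_tendsto_cocompact hq0 hη
  -- the scales `ε` (inner ramp) and `N` (outer ramp)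
  set ε : ℝ := min (δ / 2) (‖y₀‖ / 4) with hε_def
  have hε : 0 < ε := lt_min (by positivity) (by positivity)
  have hεδ : ε ≤ δ / 2 := min_le_left _ _
  have hεy : ε ≤ ‖y₀‖ / 4 := min_le_right _ _
  set N : ℝ := max R (2 * ‖y₀‖) with hN_def
  have hNR : R ≤ N := le_max_left _ _
  have hNy : 2 * ‖y₀‖ ≤ N := le_max_right _ _
  have hN : 0 < N := hR.trans_le hNR
  have hεN : 2 * ε ^ 2 ≤ N ^ 2 := by
    have h1 : 2 * ε ≤ N := by linarith
    have h2 : (2 * ε) ^ 2 ≤ N ^ 2 := pow_le_pow_left₀ (by positivity) h1 2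
    linarith [h2, sq_nonneg ε]
  -- the ramps
  obtain ⟨hκ₁s, hκ₁0r, hκ₁1r, hκ₁br, hκ₁d, hκ₁z⟩ := risingRamp_props (a := ε ^ 2) (by positivity) hC
  obtain ⟨hκ₂s, hκ₂1r, hκ₂0r, hκ₂br, hκ₂d, hκ₂z⟩ := fallingRamp_props (B := N ^ 2) (by positivity) hC
  set κ₁ : ℝ → ℝ := fun s => Real.smoothTransition ((s - ε ^ 2) / ε ^ 2) with hκ₁_def
  set κ₂ : ℝ → ℝ := fun s => Real.smoothTransition ((2 * N ^ 2 - s) / N ^ 2) with hκ₂_def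
  have hκ₁0 : ∀ s, s ≤ ε ^ 2 → κ₁ s = 0 := hκ₁0r
  have hκ₁1 : ∀ s, 2 * ε ^ 2 ≤ s → κ₁ s = 1 := hκ₁1r
  have hκ₁b : ∀ s, 0 ≤ κ₁ s ∧ κ₁ s ≤ 1 := hκ₁br
  have hκ₂1 : ∀ s, s ≤ N ^ 2 → κ₂ s = 1 := hκ₂1r
  have hκ₂0 : ∀ s, 2 * N ^ 2 ≤ s → κ₂ s = 0 := hκ₂0r
  have hκ₂b : ∀ s, 0 ≤ κ₂ s ∧ κ₂ s ≤ 1 := hκ₂br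
  -- the weight `θ(s) = κ₁ κ₂ s^{−m}`
  set θ : ℝ → ℝ := fun s => κ₁ s * κ₂ s * s ^ (-((4 * (l : ℝ) - 1) / 2)) with hθ_def
  have hκs : ContDiff ℝ (⊤ : ℕ∞) (fun s => κ₁ s * κ₂ s) := hκ₁s.mul hκ₂s
  have hθ : ContDiff ℝ (⊤ : ℕ∞) θ :=
    contDiff_mul_rpow_of_eq_zero hκs (a := ε ^ 2) (by positivity) (fun s hs => by
      show κ₁ s * κ₂ s = 0
      rw [hκ₁0 s hs, zero_mul]) _
  have hθb : ∀ s, 2 * N ^ 2 < s → θ s = 0 := fun s hs => by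
    show κ₁ s * κ₂ s * s ^ (-((4 * (l : ℝ) - 1) / 2)) = 0
    rw [hκ₂0 s hs.le, mul_zero, zero_mul]
  have hθnn : ∀ s, 0 ≤ s → 0 ≤ θ s := fun s hs => by
    show 0 ≤ κ₁ s * κ₂ s * s ^ (-((4 * (l : ℝ) - 1) / 2))
    exact mul_nonneg (mul_nonneg (hκ₁b s).1 (hκ₂b s).1) (Real.rpow_nonneg hs _)
  -- the derivative of the product ramp is the sum of the ramp derivatives
  have hκd : ∀ s, deriv (fun s => κ₁ s * κ₂ s) s = deriv κ₁ s + deriv κ₂ s := fun s => by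
    have h1 : HasDerivAt κ₁ (deriv κ₁ s) s := ((hκ₁s.differentiable (by simp)) s).hasDerivAt
    have h2 : HasDerivAt κ₂ (deriv κ₂ s) s := ((hκ₂s.differentiable (by simp)) s).hasDerivAt
    have e12 : (fun s => κ₁ s * κ₂ s) = κ₁ * κ₂ := rfl
    rw [e12, (h1.mul h2).deriv]
    by_cases hs1 : s ∈ Ioo (ε ^ 2) (2 * ε ^ 2)
    · have hs2 : s ∉ Ioo (N ^ 2) (2 * N ^ 2) := fun h => by linarith [h.1, hs1.2]
      rw [hκ₂z s hs2, hκ₂1 s (by linarith [hs1.2])]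
      ring
    · rw [hκ₁z s hs1]
      by_cases hs2 : s ∈ Ioo (N ^ 2) (2 * N ^ 2)
      · rw [hκ₁1 s (by linarith [hs2.1])]
        ring
      · rw [hκ₂z s hs2]
        ring
  -- the bracket integrand after the cancellation of the `θ`-term
  have hΦ : ∀ y : E3,
      (((4 * l : ℝ) - 1) * θ (‖y‖ ^ 2) + 2 * ‖y‖ ^ 2 * deriv θ (‖y‖ ^ 2)) =
        2 * deriv κ₁ (‖y‖ ^ 2) * (‖y‖ ^ 2) ^ (1 - ((4 * (l : ℝ) - 1) / 2))
          + 2 * deriv κ₂ (‖y‖ ^ 2) * (‖y‖ ^ 2) ^ (1 - ((4 * (l : ℝ) - 1) / 2)) := by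
    intro y
    by_cases hy : y = 0
    · subst hy
      have h0 : (0 : ℝ) ∉ Ioo (ε ^ 2) (2 * ε ^ 2) := fun h => by linarith [h.1, pow_pos hε 2]
      have h0' : (0 : ℝ) ∉ Ioo (N ^ 2) (2 * N ^ 2) := fun h => by linarith [h.1, pow_pos hN 2]
      have e0 : ‖(0 : E3)‖ ^ 2 = 0 := by simp
      rw [e0, hκ₁z 0 h0, hκ₂z 0 h0']
      have : θ 0 = 0 := by
        show κ₁ 0 * κ₂ 0 * (0:ℝ) ^ (-((4 * (l : ℝ) - 1) / 2)) = 0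
        rw [hκ₁0 _ (by positivity), zero_mul, zero_mul]
      rw [this]
      ring
    · have hs : 0 < ‖y‖ ^ 2 := by positivity
      have hw : 2 * ((4 * (l : ℝ) - 1) / 2) * θ (‖y‖ ^ 2) + 2 * ‖y‖ ^ 2 * deriv θ (‖y‖ ^ 2) =
          2 * deriv (fun s => κ₁ s * κ₂ s) (‖y‖ ^ 2) * (‖y‖ ^ 2) ^ (1 - (4 * (l : ℝ) - 1) / 2) :=
        weight_deriv_identity hκs ((4 * (l : ℝ) - 1) / 2) hs
      rw [hκd] at hw
      have e : ((4 * l : ℝ) - 1) * θ (‖y‖ ^ 2) = 2 * ((4 * (l : ℝ) - 1) / 2) * θ (‖y‖ ^ 2) := by ring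
      rw [e, hw]
      ring
  -- THE IDENTITY
  have hI := integral_virial_identity hY hq2 hprem' hθ hθb
  -- integrability of the two ramp pieces
  have hpiece : ∀ (φ : ℝ → ℝ), ContDiff ℝ (⊤ : ℕ∞) φ → (∀ s, s ≤ ε ^ 2 → φ s = 0) →
      (∀ s, 2 * N ^ 2 ≤ s → φ s = 0) → ∀ (w : E3 → ℝ), Continuous w →
      Integrable (fun y : E3 => w y * ((2 * φ (‖y‖ ^ 2) * (‖y‖ ^ 2) ^ (1 - ((4 * (l : ℝ) - 1) / 2))) *
        pbr Y (angForm Y) y)) (volume : Measure E3) := by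
    intro φ hφ hφ0 hφ1 w hw
    have hsm : ContDiff ℝ (⊤ : ℕ∞) (fun s : ℝ => φ s * s ^ (-(((4 * (l : ℝ) - 1) / 2) - 1))) :=
      contDiff_mul_rpow_of_eq_zero hφ (by positivity) hφ0 _
    have e : (fun s : ℝ => φ s * s ^ (-(((4 * (l : ℝ) - 1) / 2) - 1))) =
        fun s => φ s * s ^ (1 - ((4 * (l : ℝ) - 1) / 2)) := by
      funext s; rw [neg_sub]
    rw [e] at hsm
    have hcont : Continuous (fun y : E3 => w y * ((2 * φ (‖y‖ ^ 2) * (‖y‖ ^ 2) ^ (1 - ((4 * (l : ℝ) - 1) / 2))) *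
        pbr Y (angForm Y) y)) := by
      have h1 : Continuous (fun y : E3 => φ (‖y‖ ^ 2) * (‖y‖ ^ 2) ^ (1 - ((4 * (l : ℝ) - 1) / 2))) :=
        hsm.continuous.comp (continuous_norm.pow 2)
      have h2 : Continuous (fun y : E3 => 2 * φ (‖y‖ ^ 2) * (‖y‖ ^ 2) ^ (1 - ((4 * (l : ℝ) - 1) / 2))) := by
        have : (fun y : E3 => 2 * φ (‖y‖ ^ 2) * (‖y‖ ^ 2) ^ (1 - ((4 * (l : ℝ) - 1) / 2))) =
            fun y => 2 * (φ (‖y‖ ^ 2) * (‖y‖ ^ 2) ^ (1 - ((4 * (l : ℝ) - 1) / 2))) := by funext y; ring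
        rw [this]; exact continuous_const.mul h1
      exact hw.mul (h2.mul (contDiff_pbr_angForm hY).continuous)
    refine hcont.integrable_of_hasCompactSupport ?_
    refine HasCompactSupport.intro (isCompact_closedBall (0 : E3) (2 * N)) fun y hy => ?_
    rw [mem_closedBall_zero_iff, not_le] at hy
    have h4 : (2 * N) ^ 2 < ‖y‖ ^ 2 := pow_lt_pow_left₀ hy (by positivity) two_ne_zero
    have : φ (‖y‖ ^ 2) = 0 := hφ1 _ (by linarith [h4, sq_nonneg N])
    rw [this]; ring
  have hκ₁d0 : ∀ s, s ≤ ε ^ 2 → deriv κ₁ s = 0 := fun s hs => hκ₁z s (fun h => by linarith [h.1])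
  have hκ₁d1 : ∀ s, 2 * N ^ 2 ≤ s → deriv κ₁ s = 0 := fun s hs =>
    hκ₁z s (fun h => by linarith [h.2, hεN, sq_nonneg N])
  have hκ₂d0 : ∀ s, s ≤ ε ^ 2 → deriv κ₂ s = 0 := fun s hs =>
    hκ₂z s (fun h => by linarith [h.1, hεN, sq_nonneg ε])
  have hκ₂d1 : ∀ s, 2 * N ^ 2 ≤ s → deriv κ₂ s = 0 := fun s hs => hκ₂z s (fun h => by linarith [h.2])
  have hκ₁ds : ContDiff ℝ (⊤ : ℕ∞) (deriv κ₁) := hκ₁s.deriv'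
  have hκ₂ds : ContDiff ℝ (⊤ : ℕ∞) (deriv κ₂) := hκ₂s.deriv'
  have hqc' : Continuous (fun y : E3 => q y - q 0) := hqc.sub continuous_const
  have hint1 := hpiece (deriv κ₁) hκ₁ds hκ₁d0 hκ₁d1 q hqc
  have hint1' := hpiece (deriv κ₁) hκ₁ds hκ₁d0 hκ₁d1 (fun y => q y - q 0) hqc'
  have hint1c := hpiece (deriv κ₁) hκ₁ds hκ₁d0 hκ₁d1 (fun _ => q 0) continuous_const
  have hint2 := hpiece (deriv κ₂) hκ₂ds hκ₂d0 hκ₂d1 q hqc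
  -- the right-hand side splits into the two ramp pieces
  have hsplit : ∫ y : E3, q y * ((((4 * l : ℝ) - 1) * θ (‖y‖ ^ 2) + 2 * ‖y‖ ^ 2 * deriv θ (‖y‖ ^ 2)) * pbr Y (angForm Y) y) =
      (∫ y : E3, q y * ((2 * deriv κ₁ (‖y‖ ^ 2) * (‖y‖ ^ 2) ^ (1 - ((4 * (l : ℝ) - 1) / 2))) * pbr Y (angForm Y) y)) +
      ∫ y : E3, q y * ((2 * deriv κ₂ (‖y‖ ^ 2) * (‖y‖ ^ 2) ^ (1 - ((4 * (l : ℝ) - 1) / 2))) * pbr Y (angForm Y) y) := by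
    rw [← integral_add hint1 hint2]
    refine integral_congr_ae (Eventually.of_forall fun y => ?_)
    simp only [hΦ y]
    ring
  -- the inner piece: subtract `q 0` using the zero shell averages
  have hzero : ∫ y : E3, (2 * deriv κ₁ (‖y‖ ^ 2) * (‖y‖ ^ 2) ^ (1 - ((4 * (l : ℝ) - 1) / 2))) * pbr Y (angForm Y) y = 0 := by
    have hsm : ContDiff ℝ (⊤ : ℕ∞) (fun s : ℝ => deriv κ₁ s * s ^ (-(((4 * (l : ℝ) - 1) / 2) - 1))) :=
      contDiff_mul_rpow_of_eq_zero hκ₁ds (by positivity) hκ₁d0 _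
    have hsm2 : ContDiff ℝ (⊤ : ℕ∞) (fun s : ℝ => 2 * deriv κ₁ s * s ^ (1 - ((4 * (l : ℝ) - 1) / 2))) := by
      have e : (fun s : ℝ => 2 * deriv κ₁ s * s ^ (1 - ((4 * (l : ℝ) - 1) / 2))) =
          fun s => 2 * (deriv κ₁ s * s ^ (-(((4 * (l : ℝ) - 1) / 2) - 1))) := by
        funext s; rw [neg_sub]; ring
      rw [e]; exact contDiff_const.mul hsm
    exact integral_radialTest_mul_pbr_angForm hY hsm2 (b := 2 * N ^ 2) (fun s hs => by
      show 2 * deriv κ₁ s * s ^ (1 - ((4 * (l : ℝ) - 1) / 2)) = 0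
      rw [hκ₁d1 s hs.le]; ring)
  have hinner : ∫ y : E3, q y * ((2 * deriv κ₁ (‖y‖ ^ 2) * (‖y‖ ^ 2) ^ (1 - ((4 * (l : ℝ) - 1) / 2))) * pbr Y (angForm Y) y) =
      ∫ y : E3, (q y - q 0) * ((2 * deriv κ₁ (‖y‖ ^ 2) * (‖y‖ ^ 2) ^ (1 - ((4 * (l : ℝ) - 1) / 2))) * pbr Y (angForm Y) y) := by
    have e : ∀ y : E3, (q y - q 0) * ((2 * deriv κ₁ (‖y‖ ^ 2) * (‖y‖ ^ 2) ^ (1 - ((4 * (l : ℝ) - 1) / 2))) * pbr Y (angForm Y) y) =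
        q y * ((2 * deriv κ₁ (‖y‖ ^ 2) * (‖y‖ ^ 2) ^ (1 - ((4 * (l : ℝ) - 1) / 2))) * pbr Y (angForm Y) y) -
        (fun _ => q 0) y * ((2 * deriv κ₁ (‖y‖ ^ 2) * (‖y‖ ^ 2) ^ (1 - ((4 * (l : ℝ) - 1) / 2))) * pbr Y (angForm Y) y) :=
      fun y => by ring
    rw [integral_congr_ae (Eventually.of_forall e), integral_sub hint1 hint1c, integral_const_mul, hzero, mul_zero, sub_zero]
  -- the two ramp estimates
  have hB1 : |∫ y : E3, (q y - q 0) * ((2 * deriv κ₁ (‖y‖ ^ 2) * (‖y‖ ^ 2) ^ (1 - ((4 * (l : ℝ) - 1) / 2))) * pbr Y (angForm Y) y)|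
      ≤ 16 * (volume : Measure E3).real (closedBall (0 : E3) 1) * C * M₂ * η :=
    ramp_integral_le hl hM₂0 hM₂ hε hC0 hη.le (φ := deriv κ₁) hκ₁d hκ₁z (w := fun y => q y - q 0)
      (fun y _ hy2 => hδq y (by linarith))
  have hB2 : |∫ y : E3, q y * ((2 * deriv κ₂ (‖y‖ ^ 2) * (‖y‖ ^ 2) ^ (1 - ((4 * (l : ℝ) - 1) / 2))) * pbr Y (angForm Y) y)|
      ≤ 16 * (volume : Measure E3).real (closedBall (0 : E3) 1) * C * M₂ * η :=
    ramp_integral_le hl hM₂0 hM₂ hN hC0 hη.le (φ := deriv κ₂) hκ₂d hκ₂z (w := q)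
      (fun y hy1 _ => hRq y (hNR.trans hy1))
  -- the left-hand side: integrable and bounded below by `c₀`
  have hLint : Integrable (fun y : E3 => strainAmpL l H ‖y‖ ^ 2 * angForm Y y ^ 2 * θ (‖y‖ ^ 2)) (volume : Measure E3) := by
    have hcont : Continuous (fun y : E3 => strainAmpL l H ‖y‖ ^ 2 * angForm Y y ^ 2 * θ (‖y‖ ^ 2)) := by
      refine continuous_iff_continuousAt.2 fun y => ?_
      by_cases hy : ‖y‖ < ε
      · have hev : (fun y : E3 => strainAmpL l H ‖y‖ ^ 2 * angForm Y y ^ 2 * θ (‖y‖ ^ 2)) =ᶠ[𝓝 y] fun _ => 0 := by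
          filter_upwards [(isOpen_lt continuous_norm continuous_const).mem_nhds hy] with z hz
          have hz2 : ‖z‖ ^ 2 ≤ ε ^ 2 := pow_le_pow_left₀ (norm_nonneg z) (le_of_lt hz) 2
          show strainAmpL l H ‖z‖ ^ 2 * angForm Y z ^ 2 * (κ₁ (‖z‖ ^ 2) * κ₂ (‖z‖ ^ 2) * (‖z‖ ^ 2) ^ (-((4 * (l : ℝ) - 1) / 2))) = 0
          rw [hκ₁0 _ hz2]; ring
        exact continuousAt_const.congr_of_eventuallyEq hev  -- wrong direction? fixed below if needed
      · have hypos : 0 < ‖y‖ := hε.trans_le (not_lt.1 hy)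
        exact ((((continuousAt_strainAmpL hH hypos).comp continuous_norm.continuousAt).pow 2).mul
          ((continuous_angForm hY).continuousAt.pow 2)).mul ((hθ.continuous.comp (continuous_norm.pow 2)).continuousAt)
    refine hcont.integrable_of_hasCompactSupport ?_
    refine HasCompactSupport.intro (isCompact_closedBall (0 : E3) (2 * N)) fun y hy => ?_
    rw [mem_closedBall_zero_iff, not_le] at hy
    have h4 : (2 * N) ^ 2 < ‖y‖ ^ 2 := pow_lt_pow_left₀ hy (by positivity) two_ne_zero
    rw [hθb _ (by linarith [h4, sq_nonneg N]), mul_zero]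
  have hlow : c₀ ≤ ∫ y : E3, strainAmpL l H ‖y‖ ^ 2 * angForm Y y ^ 2 * θ (‖y‖ ^ 2) := by
    have hind : ∫ y : E3, (ball y₀ ρ₀).indicator (fun _ => strainAmpL l H ‖y₀‖ ^ 2 * angForm Y y₀ ^ 2 / 2 * w₀) y = c₀ := by
      rw [integral_indicator_const _ measurableSet_ball, smul_eq_mul]
    rw [← hind]
    refine integral_mono ?_ hLint fun y => ?_
    · exact ((continuousOn_const).integrableOn_compact (isCompact_closedBall y₀ ρ₀)).mono_set ball_subset_closedBall
        |>.integrable_indicator measurableSet_ball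
    by_cases hyU : y ∈ ball y₀ ρ₀
    · rw [indicator_of_mem hyU]
      have hd : dist y y₀ < ρ' := lt_of_lt_of_le (mem_ball.1 hyU) hρ₀1
      have hF := (hball' hd).le
      have hyy : ‖y - y₀‖ < ρ₀ := by rwa [mem_ball, dist_eq_norm] at hyU
      have hlowy : ‖y₀‖ / 2 ≤ ‖y‖ := by
        have := norm_sub_norm_le y₀ y
        rw [norm_sub_rev] at hyy
        linarith
      have hupy : ‖y‖ ≤ 3 * ‖y₀‖ / 2 := by
        have := norm_le_insert' y y₀  -- ‖y‖ ≤ ‖y₀‖ + ‖y - y₀‖ ; adjust if name differs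
        linarith
      have hypos : 0 < ‖y‖ := by linarith
      have hs0 : 0 < ‖y‖ ^ 2 := by positivity
      have a1 : ε ^ 2 ≤ (‖y₀‖ / 4) ^ 2 := pow_le_pow_left₀ hε.le hεy 2
      have a2 : (‖y₀‖ / 2) ^ 2 ≤ ‖y‖ ^ 2 := pow_le_pow_left₀ (by positivity) hlowy 2
      have a3 : ‖y‖ ^ 2 ≤ (3 * ‖y₀‖ / 2) ^ 2 := pow_le_pow_left₀ (norm_nonneg y) hupy 2
      have a4 : (2 * ‖y₀‖) ^ 2 ≤ N ^ 2 := pow_le_pow_left₀ (by positivity) hNy 2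
      have hs1 : 2 * ε ^ 2 ≤ ‖y‖ ^ 2 := by linarith [a1, a2, sq_nonneg ‖y₀‖]
      have hs2 : ‖y‖ ^ 2 ≤ N ^ 2 := by linarith [a3, a4, sq_nonneg ‖y₀‖]
      have hθy : w₀ ≤ θ (‖y‖ ^ 2) := by
        show w₀ ≤ κ₁ (‖y‖ ^ 2) * κ₂ (‖y‖ ^ 2) * (‖y‖ ^ 2) ^ (-((4 * (l : ℝ) - 1) / 2))
        rw [hκ₁1 _ hs1, hκ₂1 _ hs2, one_mul, one_mul]
        exact rpow_neg_antitone hm0 hs0 a3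
      calc strainAmpL l H ‖y₀‖ ^ 2 * angForm Y y₀ ^ 2 / 2 * w₀
          ≤ (strainAmpL l H ‖y‖ ^ 2 * angForm Y y ^ 2) * θ (‖y‖ ^ 2) :=
            mul_le_mul hF hθy hw₀.le (by positivity)
        _ = strainAmpL l H ‖y‖ ^ 2 * angForm Y y ^ 2 * θ (‖y‖ ^ 2) := by ring
    · rw [indicator_of_notMem hyU]
      exact mul_nonneg (by positivity) (hθnn _ (by positivity))
  -- contradiction
  have hup : ∫ y : E3, strainAmpL l H ‖y‖ ^ 2 * angForm Y y ^ 2 * θ (‖y‖ ^ 2) ≤ 2 * K₁ * η := by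
    rw [hI, hsplit, hinner]
    have h1 := le_abs_self (∫ y : E3, (q y - q 0) * ((2 * deriv κ₁ (‖y‖ ^ 2) * (‖y‖ ^ 2) ^ (1 - ((4 * (l : ℝ) - 1) / 2))) * pbr Y (angForm Y) y))
    have h2 := le_abs_self (∫ y : E3, q y * ((2 * deriv κ₂ (‖y‖ ^ 2) * (‖y‖ ^ 2) ^ (1 - ((4 * (l : ℝ) - 1) / 2))) * pbr Y (angForm Y) y))
    rw [hK₁]
    linarith [hB1, hB2]
  linarith [hlow, hup, hηK]

end Summit.NavierStokesRegularity.NavierStokesRegularity.Theorems.UnthreadedRigidity.ThreadingJets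

end
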